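import Mathlib
import HarnessLib
import Summits.HubbardSuperconductivity.HubbardSuperconductivity.Theses.KLProgramme
import Summits.HubbardSuperconductivity.HubbardSuperconductivity.Theorems.KLProgrammeH10TwoPointLimitVitaliLineNearZero
import Summits.HubbardSuperconductivity.HubbardSuperconductivity.Theorems.KLProgrammeH10RungCompactBoxTruncated

/-!
# Route `KLProgramme` — crux K1 `H10TwoPointLimit` (stmt-HubbardSuperconductivity-19938): the EXACT ENGINE TARGET of the Vitali line,
# stated on the CANONICAL complex-coupling objects of the torus — zero-freeness of the partition function and an `L`-uniform bound of the
# canonical Gibbs ratio on the STRIP `|Re u| < a₀ / log β`, `|Im u| < κ / β`, for `β ≥ β₀` only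

Seat leafhand-hubbard-klprogramme-4 (visitor hand on K1, 2026-08-31), continuation of `…Theorems.KLProgrammeH10TwoPointLimitVitaliLineNearZero`
(p794945/p795316: K1 ⇐ holomorphic `G_L` on SOME open preconnected `Ω ∋ 0 ⊇ [0, U]`, locally `L`-uniformly bounded, agreeing with the
two-point function near `0`).  This module removes the three remaining degrees of freedom of that input, so that the one open stub of the
line is a statement about named tree objects with no existential over functions or domains:

* **the domain** is the open rectangle `S(β) = {u : |Re u| < a₀ / log β ∧ |Im u| < κ / β}` and only temperatures `β ≥ β₀`, `β > 1` are asked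
  (below `max β₀ 2` the CLOSED compact-box corner `h10rung_twoPoint_limit_box` serves K1; `a := a₀ / 2` puts every admissible coupling
  `0 < U`, `β ≤ e^{a/U}` strictly inside the half-width, `lt_div_log_of_le_exp_half`) — `H10TwoPointLimit_of_strip`.
  WHY A STRIP AND NOT THE DISC `|u| < a₀ / log β`: at complex coupling the Hartree shift `u·n/2` is a COMPLEX shift of the chemical
  potential; once `β·|Im u| ≳ π` it cancels a Matsubara frequency and the temperature no longer cuts the infrared off (the tree's own
  complex-coupling bridge `hubbardRatio_eq_grid` is stated under `|β·Im(u/2 + uT)| ≤ π/4` for exactly this reason).  An engine can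
  certify `L`-uniform bounds on `|Im u| ≲ κ/β` × `|Re u| ≲ a₀/log β`, not on that disc; the strip is convex, hence preconnected, which is
  all Vitali–Porter needs.
* **the functions** are the CANONICAL continuations `u ↦ ⟨c†_{xσ} c_{yσ'}⟩_{β, H_L(0) + u·(H_L(1) − H_L(0))}` — the Gibbs ratio of the affine
  family through the free (`U = 0`) and unit-coupling (`U = 1`) torus Hamiltonians (`H_L(1) − H_L(0) = Σ_x n_{x↑} n_{x↓}`,
  `hamiltonianWith_eq_dGamma_add_smul`; `hubbardTorusWith_affine`), equal to `hubbardThermalTwoPoint β t μ L x y σ σ'` at real `t`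
  (`thermalCorr_affine_ofReal`; this is `hubbardThermalTwoPointC` of `Literature…HubbardFermiLiquidVitali`, spelled with built modules only),
  so the agreement clause disappears — `H10TwoPointLimit_of_canonical_strip` (pointwise complex differentiability + one bound on the strip);
* **holomorphy** of a Gibbs ratio of an affine family at `u₀` follows from `tr e^{-β(H₀ + u₀ V)} ≠ 0` (`analyticAt_thermalCorr_affine`: exp of
  an affine family, trace, inverse off the zero set), whence **`H10TwoPointLimit_of_zeroFree_strip`**: K1 ⇐ `∃ a₀ κ > 0, β₀: ∀ β ≥ β₀ (β > 1),
  ∀ μ ∈ [-1, -0.15], ∀ sites/spins, ∃ L₀ M, ∀ L ≥ L₀ (L ≠ 0), ∀ u ∈ S(β), Z_L(u) ≠ 0 ∧ ‖⟨c†_{xσ} c_{yσ'}⟩_{β,L,u,μ}‖ ≤ M` — Lee–Yang-type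
  zero-freeness IN THE COUPLING plus ONE volume-uniform bound, nothing else (no agreement clause, no domain to choose, no termwise limits, no
  power series at the target coupling);
* the Matsubara-family form of the same target (`H10TwoPointLimit_of_matsubaraStrip`: a finite-`M` family bounded on `S(β)` uniformly in
  `L, M`, the output SHAPE of `HubbardBetaUBound.norm_hubbardRatio_le_betaUMb`, there on the disc `|u| ≤ κ_U/β`).

Everything here is PROVED (compositions + one analyticity lemma); no definition, no named fact; nothing about the Hubbard model is asserted
beyond the CLOSED theorems cited.  The remaining content of K1 on this line is exactly the hypothesis of `H10TwoPointLimit_of_zeroFree_strip`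
(BGM 2006 Thm 2.1-type sectorised multiscale bounds at complex coupling in the strip; XL; in the tree only on the disc `|u| < κ/β` of
`…H10RungBetaUCorner.R0_core`).  References: BGM 2006 [cite: BenfattoGiulianiMastropietro2006, Thm 1.1, Thm 2.1, §2.2 footnote 1];
Vitali–Porter [folklore].
-/

noncomputable section

namespace Summit.HubbardSuperconductivity.HubbardSuperconductivity.Theorems.H10VitaliLine

set_option linter.dupNamespace false -- summit = problem name (single-conjunct summit), D-0017

open Filter Set Metric Topology Complex
open scoped Matrix.Norms.L2Operator ComplexOrder
open Literature.MathematicalPhysics.QuantumLattice Literature.Probability.LatticeModels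

/-! ## §1 The strip `{|Re u| < r, |Im u| < k}`: open, convex, contains `0` and the real segments `[0, U]`, `U < r` -/

/-- The coordinate rectangle `{u : |Re u| < r ∧ |Im u| < k}` is open. [folklore] -/
theorem isOpen_reImStrip (r k : ℝ) : IsOpen {z : ℂ | |z.re| < r ∧ |z.im| < k} :=
  (isOpen_lt (continuous_abs.comp Complex.continuous_re) continuous_const).inter
    (isOpen_lt (continuous_abs.comp Complex.continuous_im) continuous_const)

/-- The coordinate rectangle `{u : |Re u| < r ∧ |Im u| < k}` is convex (hence preconnected). [folklore] -/
theorem convex_reImStrip (r k : ℝ) : Convex ℝ {z : ℂ | |z.re| < r ∧ |z.im| < k} := by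
  have h : {z : ℂ | |z.re| < r ∧ |z.im| < k} =
      ({z : ℂ | -r < z.re} ∩ {z : ℂ | z.re < r}) ∩ ({z : ℂ | -k < z.im} ∩ {z : ℂ | z.im < k}) := by
    ext z
    simp only [mem_setOf_eq, mem_inter_iff, abs_lt]
  rw [h]
  exact ((convex_halfSpace_re_gt (-r)).inter (convex_halfSpace_re_lt r)).inter
    ((convex_halfSpace_im_gt (-k)).inter (convex_halfSpace_im_lt k))

/-- `0` lies in the rectangle with positive half-widths. [folklore] -/
theorem zero_mem_reImStrip {r k : ℝ} (hr : 0 < r) (hk : 0 < k) : (0 : ℂ) ∈ {z : ℂ | |z.re| < r ∧ |z.im| < k} := by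
  simp only [mem_setOf_eq, Complex.zero_re, Complex.zero_im, abs_zero]
  exact ⟨hr, hk⟩

/-- The real segment `[0, U]` lies in the rectangle as soon as `U < r`. [folklore] -/
theorem ofReal_mem_reImStrip {r k U t : ℝ} (hk : 0 < k) (hUr : U < r) (ht : t ∈ Icc (0 : ℝ) U) :
    ((t : ℝ) : ℂ) ∈ {z : ℂ | |z.re| < r ∧ |z.im| < k} := by
  simp only [mem_setOf_eq, Complex.ofReal_re, Complex.ofReal_im, abs_zero]
  exact ⟨by rw [abs_of_nonneg ht.1]; exact ht.2.trans_lt hUr, hk⟩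

/-- **K1's regime sits inside the half-width**: with `a := a₀/2`, for `β > 1` every admissible coupling `0 < U`, `β ≤ e^{a/U}` satisfies
`U < a₀ / log β` (i.e. `U·log β ≤ a₀/2 < a₀`). [folklore] -/
theorem lt_div_log_of_le_exp_half {a₀ U β : ℝ} (ha₀ : 0 < a₀) (hU : 0 < U) (hβ : 1 < β)
    (hβU : β ≤ Real.exp (a₀ / 2 / U)) : U < a₀ / Real.log β := by
  have hlog : 0 < Real.log β := Real.log_pos hβ
  have h1 : Real.log β ≤ a₀ / 2 / U := (Real.log_le_iff_le_exp (zero_lt_one.trans hβ)).2 hβU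
  rw [lt_div_iff₀ hlog]
  have h2 : U * Real.log β ≤ U * (a₀ / 2 / U) := mul_le_mul_of_nonneg_left h1 hU.le
  have h3 : U * (a₀ / 2 / U) = a₀ / 2 := by field_simp
  linarith

/-! ## §2 K1 from `L`-uniformly bounded holomorphic extensions on the strip, `β ≥ β₀` only (compact box below) -/

/-- **Crux K1 `H10TwoPointLimit` from the STRIP**: if there are `a₀, κ > 0` and `β₀` such that for every `β ≥ β₀` with `β > 1`, every `μ` in the
analysis window `[-1, -0.15]` and all sites/spins there are `L₀`, a bound `M` and, for `L ≥ L₀`, functions `G_L` complex differentiable on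
`S(β) = {|Re u| < a₀/log β, |Im u| < κ/β}` with `‖G_L‖ ≤ M` there and `G_L t = ⟨c†_{xσ} c_{yσ'}⟩_{β,L,t,μ}` for `0 < |t| < ρ_L` (some `ρ_L > 0`),
then K1 holds (with `a := a₀/2` and the `U₀` of the closed compact-box corner at `B = max β₀ 2`).
[cite: BenfattoGiulianiMastropietro2006, Thm 1.1 / Thm 2.1] -/
theorem H10TwoPointLimit_of_strip {a₀ κ β₀ : ℝ} (ha₀ : 0 < a₀) (hκ : 0 < κ)
    (h : ∀ β : ℝ, β₀ ≤ β → 1 < β → ∀ μ ∈ Set.Icc (-1 : ℝ) (-0.15), ∀ (x y : Site 2) (σ σ' : Fin 2),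
      ∃ (L₀ : ℕ) (M : ℝ) (G : ℕ → ℂ → ℂ),
        (∀ L, L₀ ≤ L → DifferentiableOn ℂ (G L) {z : ℂ | |z.re| < a₀ / Real.log β ∧ |z.im| < κ / β}) ∧
        (∀ L, L₀ ≤ L → ∀ z ∈ {z : ℂ | |z.re| < a₀ / Real.log β ∧ |z.im| < κ / β}, ‖G L z‖ ≤ M) ∧
        (∀ L, L₀ ≤ L → ∃ ρ : ℝ, 0 < ρ ∧ ∀ t : ℝ, 0 < |t| → |t| < ρ →
          G L (t : ℂ) = hubbardThermalTwoPoint β t μ L x y σ σ')) :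
    Summit.HubbardSuperconductivity.HubbardSuperconductivity.Theses.KLProgramme.H10TwoPointLimit := by
  -- the closed compact-box corner below `B := max β₀ 2`
  set B : ℝ := max β₀ 2 with hB_def
  obtain ⟨r, hr, hbox⟩ := h10rung_twoPoint_limit_box B (-1) (-0.15)
  refine ⟨r / 2, a₀ / 2, half_pos hr, half_pos ha₀, fun δ hδ U β hU hUle hβ hβa x y σ σ' => ?_⟩
  have hμ := Summit.HubbardSuperconductivity.HubbardSuperconductivity.Theses.KLProgramme.MuOfDopingWindow_holds δ hδ
  by_cases hβB : β ≤ B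
  · -- compact box
    have hUr : |U| < r := by rw [abs_of_pos hU]; linarith
    exact hbox β ⟨hβ, hβB⟩ _ hμ U hUr x y σ σ'
  · -- the strip at `β > B ≥ max β₀ 2`
    have hβB' : B < β := lt_of_not_ge hβB
    have hβ₀ : β₀ ≤ β := (le_max_left _ _).trans hβB'.le
    have hβ1 : 1 < β := by have h2 : (2 : ℝ) ≤ B := le_max_right β₀ 2; linarith
    obtain ⟨L₀, M, G, hd, hM, hagree⟩ := h β hβ₀ hβ1 _ hμ x y σ σ'
    have hUr : U < a₀ / Real.log β := lt_div_log_of_le_exp_half ha₀ hU hβ1 hβa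
    exact tendsto_hubbardThermalTwoPoint_of_connected_extension_nearZero hβ _ x y σ σ'
      (isOpen_reImStrip _ _) (convex_reImStrip _ _).isPreconnected
      (zero_mem_reImStrip (div_pos ha₀ (Real.log_pos hβ1)) (div_pos hκ hβ)) hd
      (fun _ _ => ⟨M, 1, one_pos, fun L hL z hz => hM L hL z hz.2⟩) hagree hU
      (fun t ht => ofReal_mem_reImStrip (div_pos hκ hβ) hUr ht)

/-! ## §3 Gibbs ratios of affine families: holomorphy off the zeros of the partition function -/

/-- **Gibbs ratios of an affine family are holomorphic off the zeros of the partition function**: for matrices `H₀, V, A, B` and `u₀ ∈ ℂ`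
with `tr e^{-β(H₀ + u₀V)} ≠ 0`, `u ↦ ⟨A B⟩_{β, H₀ + uV} = tr(e^{-β(H₀+uV)} A B)/tr e^{-β(H₀+uV)}` is analytic at `u₀` (exp of an affine
family, trace, inverse off the zero set). [folklore] -/
theorem analyticAt_thermalCorr_affine {n : Type*} [Fintype n] [DecidableEq n] (β : ℝ) (H₀ V A B : Matrix n n ℂ) {u₀ : ℂ}
    (hZ : Matrix.partitionFn β (H₀ + u₀ • V) ≠ 0) :
    AnalyticAt ℂ (fun u : ℂ => Matrix.thermalCorr β (H₀ + u • V) A B) u₀ := by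
  have haff : AnalyticAt ℂ (fun u : ℂ => -(β : ℂ) • (H₀ + u • V)) u₀ :=
    (analyticAt_const (v := -(β : ℂ))).smul (analyticAt_const.add (analyticAt_id.smul analyticAt_const))
  have hexp : AnalyticAt ℂ (fun u : ℂ => Matrix.gibbsWeight β (H₀ + u • V)) u₀ := by
    unfold Matrix.gibbsWeight
    exact (NormedSpace.exp_analytic _).comp haff
  have htr : ∀ C : Matrix n n ℂ, AnalyticAt ℂ (fun u : ℂ => (Matrix.gibbsWeight β (H₀ + u • V) * C).trace) u₀ := by
    intro C
    have h1 : AnalyticAt ℂ (fun u : ℂ => Matrix.gibbsWeight β (H₀ + u • V) * C) u₀ := hexp.mul analyticAt_const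
    set Λtr := (Matrix.traceLinearMap n ℂ ℂ).toContinuousLinearMap with hΛtr
    have h2 : AnalyticAt ℂ (⇑Λtr ∘ fun u : ℂ => Matrix.gibbsWeight β (H₀ + u • V) * C) u₀ := (Λtr.analyticAt _).comp h1
    refine h2.congr (Eventually.of_forall fun u => ?_)
    simp [hΛtr]
  have hZan : AnalyticAt ℂ (fun u : ℂ => Matrix.partitionFn β (H₀ + u • V)) u₀ := by
    have h := htr 1
    simp only [mul_one] at h
    exact h
  have h := (hZan.inv hZ).mul (htr (A * B))
  refine h.congr (Eventually.of_forall fun u => ?_)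
  simp only [Pi.mul_apply, Pi.inv_apply, Matrix.thermalCorr, Matrix.gibbsState_apply]

/-- **The torus Hamiltonian is affine in the coupling**, through its values at `U = 0` and `U = 1`:
`H_L(t) = H_L(0) + t·(H_L(1) − H_L(0))` (and `H_L(1) − H_L(0) = Σ_x n_{x↑} n_{x↓}`, `hamiltonianWith_eq_dGamma_add_smul`).
[cite: BenfattoGiulianiMastropietro2006, eq. (1.1)] -/
theorem hubbardTorusWith_affine (L : ℕ) (t μ : ℝ) :
    hubbardTorusWith 2 L 1 t μ =
      hubbardTorusWith 2 L 1 0 μ + (t : ℂ) • (hubbardTorusWith 2 L 1 1 μ - hubbardTorusWith 2 L 1 0 μ) := by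
  change hamiltonianWith (fermionTorusGraph 2 L) 1 t μ = hamiltonianWith (fermionTorusGraph 2 L) 1 0 μ +
    (t : ℂ) • (hamiltonianWith (fermionTorusGraph 2 L) 1 1 μ - hamiltonianWith (fermionTorusGraph 2 L) 1 0 μ)
  simp only [hamiltonianWith_eq_dGamma_add_smul, Complex.ofReal_zero, zero_smul, add_zero, Complex.ofReal_one, one_smul,
    add_sub_cancel_left]

/-- **The canonical continuation restricts to the two-point function**: for `L ≠ 0` and real `t`, the Gibbs ratio of the affine family
`H_L(0) + u·(H_L(1) − H_L(0))` at `u = t` is `⟨c†_{xσ} c_{yσ'}⟩_{β,L,t,μ}`. [cite: BenfattoGiulianiMastropietro2006, §1] -/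
theorem thermalCorr_affine_ofReal (β μ t : ℝ) (L : ℕ) [NeZero L] (x y : Site 2) (σ σ' : Fin 2) :
    Matrix.thermalCorr β (hubbardTorusWith 2 L 1 0 μ + (t : ℂ) • (hubbardTorusWith 2 L 1 1 μ - hubbardTorusWith 2 L 1 0 μ))
        (creation (orb (FermionTorus.ofTorusSite (Torus.proj L x)) σ))
        (annihilation (orb (FermionTorus.ofTorusSite (Torus.proj L y)) σ')) =
      hubbardThermalTwoPoint β t μ L x y σ σ' := by
  rw [← hubbardTorusWith_affine L t μ]
  simp only [hubbardThermalTwoPoint, NeZero.ne L, ↓reduceDIte]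

/-! ## §4 K1 from the CANONICAL continuation on the strip: no agreement clause -/

/-- **Crux K1 from the CANONICAL continuation on the strip**: if there are `a₀, κ > 0` and `β₀` such that for every `β ≥ β₀` with `β > 1`,
every `μ ∈ [-1, -0.15]` and all sites/spins there are `L₀, M` with, for every `L ≥ L₀`, `L ≠ 0`, and every `u` in the strip `S(β)`, the
canonical continuation `u ↦ ⟨c†_{xσ} c_{yσ'}⟩_{β, H_L(0) + u·(H_L(1) − H_L(0))}` complex differentiable at `u` and bounded by `M` in norm
at `u`, then K1. [cite: BenfattoGiulianiMastropietro2006, Thm 1.1 / Thm 2.1] -/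
theorem H10TwoPointLimit_of_canonical_strip {a₀ κ β₀ : ℝ} (ha₀ : 0 < a₀) (hκ : 0 < κ)
    (h : ∀ β : ℝ, β₀ ≤ β → 1 < β → ∀ μ ∈ Set.Icc (-1 : ℝ) (-0.15), ∀ (x y : Site 2) (σ σ' : Fin 2),
      ∃ (L₀ : ℕ) (M : ℝ), ∀ (L : ℕ) [NeZero L], L₀ ≤ L → ∀ z ∈ {z : ℂ | |z.re| < a₀ / Real.log β ∧ |z.im| < κ / β},
        DifferentiableAt ℂ (fun u : ℂ => Matrix.thermalCorr β
            (hubbardTorusWith 2 L 1 0 μ + u • (hubbardTorusWith 2 L 1 1 μ - hubbardTorusWith 2 L 1 0 μ))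
            (creation (orb (FermionTorus.ofTorusSite (Torus.proj L x)) σ))
            (annihilation (orb (FermionTorus.ofTorusSite (Torus.proj L y)) σ'))) z ∧
        ‖Matrix.thermalCorr β (hubbardTorusWith 2 L 1 0 μ + z • (hubbardTorusWith 2 L 1 1 μ - hubbardTorusWith 2 L 1 0 μ))
            (creation (orb (FermionTorus.ofTorusSite (Torus.proj L x)) σ))
            (annihilation (orb (FermionTorus.ofTorusSite (Torus.proj L y)) σ'))‖ ≤ M) :
    Summit.HubbardSuperconductivity.HubbardSuperconductivity.Theses.KLProgramme.H10TwoPointLimit := by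
  refine H10TwoPointLimit_of_strip (β₀ := β₀) ha₀ hκ fun β hβ₀ hβ1 μ hμ x y σ σ' => ?_
  obtain ⟨L₀, M, hLM⟩ := h β hβ₀ hβ1 μ hμ x y σ σ'
  -- a total family in `L` (junk `0` at `L = 0`), equal to the canonical continuation for `L ≠ 0`
  refine ⟨max L₀ 1, M, fun L u => if hL : L = 0 then 0 else
      haveI : NeZero L := ⟨hL⟩
      Matrix.thermalCorr β (hubbardTorusWith 2 L 1 0 μ + u • (hubbardTorusWith 2 L 1 1 μ - hubbardTorusWith 2 L 1 0 μ))
        (creation (orb (FermionTorus.ofTorusSite (Torus.proj L x)) σ))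
        (annihilation (orb (FermionTorus.ofTorusSite (Torus.proj L y)) σ')), ?_, ?_, ?_⟩
  · intro L hL z hz
    have hL1 : 1 ≤ L := (le_max_right _ _).trans hL
    have hL0 : L ≠ 0 := by omega
    haveI : NeZero L := ⟨hL0⟩
    simp only [hL0, ↓reduceDIte]
    exact ((hLM L ((le_max_left _ _).trans hL) z hz).1).differentiableWithinAt
  · intro L hL z hz
    have hL1 : 1 ≤ L := (le_max_right _ _).trans hL
    have hL0 : L ≠ 0 := by omega
    haveI : NeZero L := ⟨hL0⟩
    simp only [hL0, ↓reduceDIte]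
    exact (hLM L ((le_max_left _ _).trans hL) z hz).2
  · intro L hL
    have hL1 : 1 ≤ L := (le_max_right _ _).trans hL
    have hL0 : L ≠ 0 := by omega
    haveI : NeZero L := ⟨hL0⟩
    refine ⟨1, one_pos, fun t _ _ => ?_⟩
    simp only [hL0, ↓reduceDIte]
    exact thermalCorr_affine_ofReal β μ t L x y σ σ'

/-! ## §5 K1 from zero-freeness of the partition function and ONE bound, on the strip -/

/-- **Crux K1 `H10TwoPointLimit` from ZERO-FREENESS + ONE BOUND on the strip** (the exact engine target of the Vitali line): if there are
`a₀, κ > 0` and `β₀` such that for every `β ≥ β₀` with `β > 1`, every `μ ∈ [-1, -0.15]` and all sites/spins there are `L₀, M` with, for every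
`L ≥ L₀`, `L ≠ 0`, and every `u` with `|Re u| < a₀/log β`, `|Im u| < κ/β`: the torus partition function at complex coupling
`Z_L(u) = tr e^{-β(H_L(0) + u·(H_L(1) − H_L(0)))}` is non-zero and the canonical Gibbs ratio `⟨c†_{xσ} c_{yσ'}⟩_{β,L,u,μ}` has norm `≤ M` —
then K1 holds. [cite: BenfattoGiulianiMastropietro2006, Thm 1.1 / Thm 2.1] -/
theorem H10TwoPointLimit_of_zeroFree_strip {a₀ κ β₀ : ℝ} (ha₀ : 0 < a₀) (hκ : 0 < κ)
    (h : ∀ β : ℝ, β₀ ≤ β → 1 < β → ∀ μ ∈ Set.Icc (-1 : ℝ) (-0.15), ∀ (x y : Site 2) (σ σ' : Fin 2),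
      ∃ (L₀ : ℕ) (M : ℝ), ∀ (L : ℕ) [NeZero L], L₀ ≤ L → ∀ z ∈ {z : ℂ | |z.re| < a₀ / Real.log β ∧ |z.im| < κ / β},
        Matrix.partitionFn β
            (hubbardTorusWith 2 L 1 0 μ + z • (hubbardTorusWith 2 L 1 1 μ - hubbardTorusWith 2 L 1 0 μ)) ≠ 0 ∧
        ‖Matrix.thermalCorr β (hubbardTorusWith 2 L 1 0 μ + z • (hubbardTorusWith 2 L 1 1 μ - hubbardTorusWith 2 L 1 0 μ))
            (creation (orb (FermionTorus.ofTorusSite (Torus.proj L x)) σ))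
            (annihilation (orb (FermionTorus.ofTorusSite (Torus.proj L y)) σ'))‖ ≤ M) :
    Summit.HubbardSuperconductivity.HubbardSuperconductivity.Theses.KLProgramme.H10TwoPointLimit := by
  refine H10TwoPointLimit_of_canonical_strip (β₀ := β₀) ha₀ hκ fun β hβ₀ hβ1 μ hμ x y σ σ' => ?_
  obtain ⟨L₀, M, hLM⟩ := h β hβ₀ hβ1 μ hμ x y σ σ'
  refine ⟨L₀, M, fun L _ hL z hz => ?_⟩
  obtain ⟨hZ, hM⟩ := hLM L hL z hz
  exact ⟨(analyticAt_thermalCorr_affine β _ _ _ _ hZ).differentiableAt, hM⟩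

/-! ## §6 The Matsubara-family form of the target on the strip (Montel in `M`, `…MatsubaraExtension`) -/

/-- **Crux K1 from a Matsubara-indexed family bounded on the strip** — the output SHAPE of the tree's complex-coupling engine
(`HubbardBetaUBound.norm_hubbardRatio_le_betaUMb`, there on the disc `|u| ≤ κ_U/β`), asked on `S(β)` for `β ≥ β₀`, `β > 1` only: constants
`Bd, C`, a threshold `L₀`, and for each `L ≥ L₀`: `M₀`, a constant `c` with `‖c‖ ≤ C`, `ρ > 0` and `g_M` (`M ≥ M₀`) complex differentiable on
`S(β)` with `‖g_M‖ ≤ Bd` there and `g_M(t) → ⟨c†_{xσ} c_{yσ'}⟩_{β,L,t,μ} − c` as `M → ∞` at the real `0 < |t| < ρ` in `S(β)` ⟹ K1.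
[cite: BenfattoGiulianiMastropietro2006, Thm 2.1 / §2.2 footnote 1] -/
theorem H10TwoPointLimit_of_matsubaraStrip {a₀ κ β₀ : ℝ} (ha₀ : 0 < a₀) (hκ : 0 < κ)
    (h : ∀ β : ℝ, β₀ ≤ β → 1 < β → ∀ μ ∈ Set.Icc (-1 : ℝ) (-0.15), ∀ (x y : Site 2) (σ σ' : Fin 2),
      ∃ (Bd C : ℝ) (L₀ : ℕ), ∀ L : ℕ, L₀ ≤ L →
        ∃ (M₀ : ℕ) (c : ℂ) (ρ : ℝ) (g : ℕ → ℂ → ℂ), ‖c‖ ≤ C ∧ 0 < ρ ∧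
          (∀ M, M₀ ≤ M → DifferentiableOn ℂ (g M) {z : ℂ | |z.re| < a₀ / Real.log β ∧ |z.im| < κ / β}) ∧
          (∀ M, M₀ ≤ M → ∀ z ∈ {z : ℂ | |z.re| < a₀ / Real.log β ∧ |z.im| < κ / β}, ‖g M z‖ ≤ Bd) ∧
          (∀ t : ℝ, 0 < |t| → |t| < ρ → ((t : ℝ) : ℂ) ∈ {z : ℂ | |z.re| < a₀ / Real.log β ∧ |z.im| < κ / β} →
            Tendsto (fun M : ℕ => g M (t : ℂ)) atTop (𝓝 (hubbardThermalTwoPoint β t μ L x y σ σ' - c)))) :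
    Summit.HubbardSuperconductivity.HubbardSuperconductivity.Theses.KLProgramme.H10TwoPointLimit := by
  refine H10TwoPointLimit_of_strip (β₀ := β₀) ha₀ hκ fun β hβ₀ hβ1 μ hμ x y σ σ' => ?_
  have hβ : 0 < β := zero_lt_one.trans hβ1
  obtain ⟨Bd, C, L₀, hL⟩ := h β hβ₀ hβ1 μ hμ x y σ σ'
  have h0 : (0 : ℂ) ∈ {z : ℂ | |z.re| < a₀ / Real.log β ∧ |z.im| < κ / β} :=
    zero_mem_reImStrip (div_pos ha₀ (Real.log_pos hβ1)) (div_pos hκ hβ)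
  have hG : ∀ L, L₀ ≤ L → ∃ G : ℂ → ℂ, DifferentiableOn ℂ G {z : ℂ | |z.re| < a₀ / Real.log β ∧ |z.im| < κ / β} ∧
      (∀ z ∈ {z : ℂ | |z.re| < a₀ / Real.log β ∧ |z.im| < κ / β}, ‖G z‖ ≤ Bd + C) ∧
      ∃ ρ' : ℝ, 0 < ρ' ∧ ∀ t : ℝ, 0 < |t| → |t| < ρ' → G (t : ℂ) = hubbardThermalTwoPoint β t μ L x y σ σ' := by
    intro L hLL
    obtain ⟨M₀, c, ρ, g, hc, hρ, hg, hgB, hlim⟩ := hL L hLL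
    obtain ⟨G, hGd, hGB, ρ', hρ', hagree⟩ := extension_of_matsubara_family (isOpen_reImStrip _ _) h0 hρ hg hgB hlim
    exact ⟨G, hGd, fun z hz => (hGB z hz).trans (by linarith), ρ', hρ', hagree⟩
  choose G hGd hGB ρ' hρ' hagree using hG
  refine ⟨L₀, Bd + C, fun L => if hL' : L₀ ≤ L then G L hL' else 0, ?_, ?_, ?_⟩
  · intro L hLL; simp only [hLL, ↓reduceDIte]; exact hGd L hLL
  · intro L hLL z hz; simp only [hLL, ↓reduceDIte]; exact hGB L hLL z hz
  · intro L hLL; simp only [hLL, ↓reduceDIte]; exact ⟨ρ' L hLL, hρ' L hLL, hagree L hLL⟩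

end Summit.HubbardSuperconductivity.HubbardSuperconductivity.Theorems.H10VitaliLine

end
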